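import Mathlib.Data.Matrix.Basic
import Mathlib.Data.Real.Basic
import Mathlib.Algebra.Order.BigOperators.Group.Finset
import Mathlib.Tactic
import HarnessLib

/-!
# Cohn–Umans 2003, Thm. 6.1: `SO_n(ℝ)`, unit upper and unit lower triangular matrices satisfy the TPP

Topic `Literature/Computability/AlgebraicComplexity` (group-theoretic matrix multiplication), namespace
`Literature.Computability.AlgebraicComplexity`.

H. Cohn, C. Umans, *A group-theoretic approach to fast matrix multiplication*, FOCS 2003 = arXiv:math/0307321, §6
"Lie groups" (Theorem 12 of the arXiv text, p. 8): "**Theorem 6.1.** The group `SL_n(ℝ)` has Lie pseudo-exponent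
at most `2 + 2/n`. *Proof.* The three subgroups are the group `U` of upper-triangular matrices with `1`'s on the
diagonal, the group `L` of lower-triangular matrices with `1`'s on the diagonal, and `SO_n(ℝ)`. Each subgroup has
dimension `n(n−1)/2`, and `SL_n(ℝ)` has dimension `n² − 1`, so assuming the triple product property holds, the Lie
pseudo-exponent is at most `(n²−1)/(n(n−1)/2) = 2 + 2/n`. Let `M ∈ SO_n(ℝ)`, `A ∈ U`, and `B ∈ L`. We wish to
prove that if `MA = B`, then `M = A = B = I`. Let `e₁,…,e_n` be the standard basis of `ℝⁿ`. We will prove by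
induction on `i` that `Meᵢ = eᵢ`. Once we know that `M = I`, it follows that `A = B`, and thus `A = B = I` because
`U` and `L` are disjoint except for the identity. … Since `A` is in `U`, we have `A₁ = e₁`. Thus,
`|B₁| = |MA₁| = |Me₁| = |e₁| = 1`, since `M` is an orthogonal matrix. Because `B₁₁ = 1`, the only way `|B₁|` can be
`1` is if `B₁ = e₁`. Thus, `Me₁ = e₁`. Now suppose that `Meⱼ = eⱼ` for all `j < i` …"

## Lean statement
The algebraic content (the triple product property of the three subgroups, in the subgroup form "`MA = B` forces
`M = A = B = I`"): for real `n × n` matrices with `MᵀM = 1` (orthogonal — `det M = 1` is not used by the proof),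
`A` unit upper triangular and `B` unit lower triangular, `MA = B` implies `M = 1`, `A = 1`, `B = 1`
(`CohnUmans2003_thm61`). The dimension count `(n²−1)/(n(n−1)/2) = 2 + 2/n` (the "Lie pseudo-exponent",
Def. 6.1 of the source) is arithmetic and not restated. Proof as printed (column induction `Meᵢ = eᵢ`), with
`|Meᵢ| = 1` and `Meᵢ ⊥ eⱼ (j < i)` read off `MᵀM = 1`.

## References
* H. Cohn, C. Umans, FOCS 2003, 438–449; arXiv:math/0307321, §6, Def. 6.1 and Thm. 6.1 (Definition 3 and
  Theorem 12 of the arXiv text, p. 8). [CohnUmans2003]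
-/

namespace Literature.Computability.AlgebraicComplexity

open Finset Matrix

/-- **Cohn–Umans 2003, Thm. 6.1 (the triple product property behind "`SL_n(ℝ)` has Lie pseudo-exponent at most
`2 + 2/n`")**: if `M` is orthogonal (`MᵀM = 1`), `A` is upper triangular with `1`'s on the diagonal, `B` is lower
triangular with `1`'s on the diagonal, and `MA = B`, then `M = A = B = I`.
[cite: CohnUmans2003, Thm. 6.1 (Theorem 12 of the arXiv text, p. 8)] -/
theorem CohnUmans2003_thm61 {n : ℕ} {M A B : Matrix (Fin n) (Fin n) ℝ} (hM : Mᵀ * M = 1)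
    (hA : ∀ i j : Fin n, j < i → A i j = 0) (hAd : ∀ i : Fin n, A i i = 1)
    (hB : ∀ i j : Fin n, i < j → B i j = 0) (hBd : ∀ i : Fin n, B i i = 1)
    (h : M * A = B) : M = 1 ∧ A = 1 ∧ B = 1 := by
  -- orthonormal columns: `Σ_k M k j · M k i = δ_{ji}`
  have horth : ∀ j i : Fin n, ∑ k, M k j * M k i = if j = i then 1 else 0 := by
    intro j i
    have := congrFun (congrFun hM j) i
    simpa [Matrix.mul_apply, Matrix.transpose_apply, Matrix.one_apply] using this
  -- entries of `MA`: `B k i = Σ_l M k l · A l i`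
  have hprod : ∀ k i : Fin n, ∑ l, M k l * A l i = B k i := by
    intro k i
    have := congrFun (congrFun h k) i
    simpa [Matrix.mul_apply] using this
  -- the column induction: `M eᵢ = eᵢ`
  have hcol : ∀ (t : ℕ) (i : Fin n), (i : ℕ) = t → ∀ k, M k i = if k = i then 1 else 0 := by
    intro t
    induction' t using Nat.strong_induction_on with t ih
    intro i hi
    -- induction hypothesis for the columns `j < i`
    have ihj : ∀ j : Fin n, j < i → ∀ k, M k j = if k = j then 1 else 0 :=
      fun j hj => ih j (by rw [← hi]; exact hj) j rfl
    -- (1) `M j i = 0` for `j < i` (column `i` is orthogonal to `e_j = M e_j`)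
    have hzero : ∀ j : Fin n, j < i → M j i = 0 := by
      intro j hj
      have h1 := horth j i
      rw [if_neg (ne_of_lt hj)] at h1
      have h2 : ∑ k, M k j * M k i = M j i := by
        rw [Finset.sum_congr rfl fun k _ => by rw [ihj j hj k]]
        simp [ite_mul]
      rw [h2] at h1
      exact h1
    -- (2) `B k i = M k i + [k < i] A k i`
    have hBki : ∀ k : Fin n, B k i = M k i + if k < i then A k i else 0 := by
      intro k
      rw [← hprod k i]
      have hAcol : ∀ l : Fin n, A l i = (if l = i then 1 else 0) + if l < i then A l i else 0 := by
        intro l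
        rcases lt_trichotomy l i with hl | rfl | hl
        · simp [hl, ne_of_lt hl]
        · simp [hAd]
        · simp [ne_of_gt hl, not_lt_of_gt hl, hA l i hl]
      rw [Finset.sum_congr rfl fun l _ => by rw [hAcol l]]
      simp only [mul_add, Finset.sum_add_distrib, mul_ite, mul_one, mul_zero, Finset.sum_ite_eq',
        Finset.mem_univ, if_true]
      congr 1
      have : ∀ l : Fin n, (if l < i then M k l * A l i else 0) = if l = k then (if k < i then A k i else 0) else 0 := by
        intro l
        by_cases hl : l < i
        · rw [if_pos hl, ihj l hl k]
          by_cases hkl : k = l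
          · subst hkl; simp [hl]
          · have hlk : l ≠ k := fun h' => hkl h'.symm
            simp [hkl, hlk]
        · rw [if_neg hl]
          by_cases hlk : l = k
          · subst hlk; simp [hl]
          · simp [hlk]
      rw [Finset.sum_congr rfl fun l _ => this l, Finset.sum_ite_eq' Finset.univ k, if_pos (Finset.mem_univ _)]
    -- (3) `M i i = 1`
    have hMii : M i i = 1 := by
      have := hBki i
      rw [hBd, if_neg (lt_irrefl i)] at this
      linarith
    -- (4) `|M e_i| = 1` forces the other entries of column `i` to vanish
    have hnorm : ∑ k ∈ Finset.univ.erase i, M k i * M k i = 0 := by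
      have h1 := horth i i
      rw [if_pos rfl, ← Finset.add_sum_erase _ _ (Finset.mem_univ i), hMii] at h1
      linarith
    have hoff : ∀ k : Fin n, k ≠ i → M k i = 0 := by
      intro k hk
      have := (Finset.sum_eq_zero_iff_of_nonneg fun k _ => mul_self_nonneg (M k i)).1 hnorm k
        (Finset.mem_erase.2 ⟨hk, Finset.mem_univ k⟩)
      exact mul_self_eq_zero.1 this
    intro k
    by_cases hk : k = i
    · subst hk; simp [hMii]
    · simp [hk, hoff k hk]
  have hM1 : M = 1 := by
    ext k i
    rw [hcol i i rfl k, Matrix.one_apply]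
  -- `A = B` from `M = I`, and `U ∩ L = {I}`
  have hAB : A = B := by rw [← h, hM1, Matrix.one_mul]
  have hA1 : A = 1 := by
    ext i j
    rw [Matrix.one_apply]
    rcases lt_trichotomy i j with hij | rfl | hij
    · rw [if_neg (ne_of_lt hij), hAB]; exact hB i j hij
    · rw [if_pos rfl]; exact hAd i
    · rw [if_neg (ne_of_gt hij)]; exact hA i j hij
  exact ⟨hM1, hA1, by rw [← hAB, hA1]⟩

end Literature.Computability.AlgebraicComplexity
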